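import Summits.RiemannHypothesis.RiemannHypothesis.Theorems.WeilGroundStateGroundStatesConvergeToXiStubZeroSampling
import HarnessLib

/-!
# Stub `stub_logWeightedAssembly` of the line `Sketch` (crux `WeilGroundState.GroundStatesConvergeToXi`,
item stmt-RiemannHypothesis-1527, rev L9)

The log-weighted twin of `zeroSampling_main`: for continuous `F, F₁, F₂` put
`Φ_x(t) = ‖F(x+it)‖² + 2‖F₁(x+it)‖² + ‖F₂(x+it)‖²`, `G(t) = ∫_{x ∈ [0,1]} Φ_x(t)` and
`I(k) = ∫_{[k-1,k+1]} G`.  If the vertical lines `x ∈ [0,1]` carry the *weighted* budget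
`∫ Φ_x(t) log(|t|+2) dt ≤ B`, every non-trivial zero `ρ` of `ζ` is sampled by
`‖F ρ‖² ≤ 4 I(round (Im ρ))`, and unit windows carry `≤ C₀ log(|τ|+2)` zeros (with multiplicity),
then `∑_ρ m(ρ) ‖F ρ‖² ≤ 48 C₀ B`, summably — the conclusion is free of logarithms.

Proof.  Fubini (`zeroSampling_budget` applied to the jointly continuous weighted integrand)
makes `W(t) = G(t) log(|t|+2)` integrable with `∫ W ≤ B`.  On the window `[k-1, k+1]` one has
`log(|k|+2) ≤ 2 log(|t|+2)`, whence `log(|k|+2) I(k) ≤ 2 ∫_{[k-1,k+1]} W`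
(`integral_mono_of_nonneg`).  Grouping a finite set of zeros by `k = round (Im ρ)`
(`Finset.sum_fiberwise_of_maps_to`) and using the window count with `τ = k` gives
`∑_{ρ ∈ T} m(ρ)‖F ρ‖² ≤ 8 C₀ ∑_k ∫_{[k-1,k+1]} W ≤ 24 C₀ ∫ W ≤ 24 C₀ B` by the threefold
overlap of the windows (`zeroSampling_sum_window_le`); summability follows from the uniform
bound on the partial sums (`summable_of_sum_le`).
-/

set_option linter.dupNamespace false

noncomputable section

open MeasureTheory Complex Filter Set
open scoped Real Topology ComplexConjugate

namespace Summit.RiemannHypothesis.RiemannHypothesis.Theorems.GroundStatesConvergeToXi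

open Literature.NumberTheory.LFunctions

/-- On the window `t ∈ [k-1, k+1]` one has `log(|k| + 2) ≤ 2 log(|t| + 2)`. [folklore] -/
theorem logAssembly_log_le {k : ℤ} {t : ℝ} (ht : t ∈ Icc ((k : ℝ) - 1) ((k : ℝ) + 1)) :
    Real.log (|(k : ℝ)| + 2) ≤ 2 * Real.log (|t| + 2) := by
  have hkt : |(k : ℝ) - t| ≤ 1 := abs_sub_le_iff.2 ⟨by linarith [ht.1], by linarith [ht.2]⟩
  have hk : |(k : ℝ)| ≤ |t| + 1 := by
    have h2 := abs_sub_abs_le_abs_sub (k : ℝ) t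
    linarith
  have ht0 : 0 ≤ |t| := abs_nonneg t
  calc Real.log (|(k : ℝ)| + 2) ≤ Real.log ((|t| + 2) ^ 2) := by
        refine Real.log_le_log (by positivity) ?_
        nlinarith
    _ = 2 * Real.log (|t| + 2) := by
        rw [Real.log_pow]; norm_num

/-- The combinatorial zero sum, log-free form: if every non-trivial zero `ρ` satisfies
`‖F ρ‖² ≤ 4 I(round (Im ρ))` with `I ≥ 0`, the windows satisfy `log(|k|+2) I(k) ≤ 2 J(k)`, and
unit windows carry `≤ C₀ log(|τ|+2)` zeros, then
`∑_{ρ ∈ T} m(ρ)‖F ρ‖² ≤ 8 C₀ ∑_k J(k)` over the rounded ordinates `k` of `T`. [folklore] -/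
theorem logAssembly_finset_le {F : ℂ → ℂ} {I J : ℤ → ℝ} {C₀ : ℝ} (hC₀ : 0 ≤ C₀)
    (hcount : ∀ (τ : ℝ) (T : Finset ℂ),
      (∀ ρ ∈ T, ρ ∈ ZetaZeros.riemannZetaNontrivialZeros ∧ |ρ.im - τ| ≤ 1 / 2) →
        ∑ ρ ∈ T, (riemannZetaZeroOrder ρ : ℝ) ≤ C₀ * Real.log (|τ| + 2))
    (hI : ∀ k, 0 ≤ I k)
    (hIJ : ∀ k : ℤ, Real.log (|(k : ℝ)| + 2) * I k ≤ 2 * J k)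
    (hF : ∀ ρ ∈ ZetaZeros.riemannZetaNontrivialZeros, ‖F ρ‖ ^ 2 ≤ 4 * I (round ρ.im))
    (T : Finset ℂ) (hT : ∀ ρ ∈ T, ρ ∈ ZetaZeros.riemannZetaNontrivialZeros) :
    ∑ ρ ∈ T, (riemannZetaZeroOrder ρ : ℝ) * ‖F ρ‖ ^ 2 ≤
      8 * C₀ * ∑ k ∈ T.image (fun ρ : ℂ => round ρ.im), J k := by
  have hmaps : ∀ ρ ∈ T, round ρ.im ∈ T.image (fun ρ : ℂ => round ρ.im) :=
    fun ρ hρ => Finset.mem_image_of_mem (fun ρ : ℂ => round ρ.im) hρ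
  rw [← Finset.sum_fiberwise_of_maps_to hmaps, Finset.mul_sum]
  refine Finset.sum_le_sum fun k _ => ?_
  have hterm : ∀ ρ ∈ T.filter (fun ρ : ℂ => round ρ.im = k),
      (riemannZetaZeroOrder ρ : ℝ) * ‖F ρ‖ ^ 2 ≤ (4 * I k) * (riemannZetaZeroOrder ρ : ℝ) := by
    intro ρ hρ
    rw [Finset.mem_filter] at hρ
    obtain ⟨hρT, hk'⟩ := hρ
    have hz := hT ρ hρT
    have hm : (0 : ℝ) ≤ riemannZetaZeroOrder ρ := by
      exact_mod_cast riemannZetaZeroOrder_nonneg (ZetaZeros.riemannZetaNontrivialZeros.ne_one hz)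
    have hFρ : ‖F ρ‖ ^ 2 ≤ 4 * I k := by rw [← hk']; exact hF ρ hz
    calc (riemannZetaZeroOrder ρ : ℝ) * ‖F ρ‖ ^ 2
        ≤ (riemannZetaZeroOrder ρ : ℝ) * (4 * I k) := mul_le_mul_of_nonneg_left hFρ hm
      _ = (4 * I k) * (riemannZetaZeroOrder ρ : ℝ) := mul_comm _ _
  calc ∑ ρ ∈ T with round ρ.im = k, (riemannZetaZeroOrder ρ : ℝ) * ‖F ρ‖ ^ 2
      ≤ ∑ ρ ∈ T with round ρ.im = k, (4 * I k) * (riemannZetaZeroOrder ρ : ℝ) :=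
        Finset.sum_le_sum hterm
    _ = (4 * I k) * ∑ ρ ∈ T with round ρ.im = k, (riemannZetaZeroOrder ρ : ℝ) := by
        rw [Finset.mul_sum]
    _ ≤ (4 * I k) * (C₀ * Real.log (|(k : ℝ)| + 2)) := by
        refine mul_le_mul_of_nonneg_left (hcount k _ fun ρ hρ => ?_) (by linarith [hI k])
        rw [Finset.mem_filter] at hρ
        have hk' : round ρ.im = k := hρ.2
        refine ⟨hT ρ hρ.1, ?_⟩
        rw [← hk']
        exact abs_sub_round ρ.im
    _ = 4 * C₀ * (Real.log (|(k : ℝ)| + 2) * I k) := by ring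
    _ ≤ 4 * C₀ * (2 * J k) := mul_le_mul_of_nonneg_left (hIJ k) (by positivity)
    _ = 8 * C₀ * J k := by ring

/-- **Stub W10a — `logWeightedAssembly` (the log-weighted twin of `zeroSampling_main`).**
For continuous `F, F₁, F₂` with `Φ_x(t) = ‖F(x+it)‖² + 2‖F₁(x+it)‖² + ‖F₂(x+it)‖²`: the window
count `∑_{|Im ρ - τ| ≤ 1/2} m(ρ) ≤ C₀ log(|τ|+2)`, the *log-weighted* line budgets
`∫ Φ_x(t) log(|t|+2) dt ≤ B` (`x ∈ [0,1]`) and the box samples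
`‖F ρ‖² ≤ 4 ∫_{[k-1,k+1]} ∫_{[0,1]} Φ` (`k = round (Im ρ)`) give the *log-free* bound
`∑_ρ m(ρ) ‖F ρ‖² ≤ 48 C₀ B`, the series over the non-trivial zeros being summable. [folklore] -/
theorem stub_logWeightedAssembly :
    ∀ (C₀ B : ℝ) (F F₁ F₂ : ℂ → ℂ), 0 ≤ C₀ →
      (∀ (τ : ℝ) (T : Finset ℂ),
        (∀ ρ ∈ T, ρ ∈ ZetaZeros.riemannZetaNontrivialZeros ∧ |ρ.im - τ| ≤ 1 / 2) →
          ∑ ρ ∈ T, (riemannZetaZeroOrder ρ : ℝ) ≤ C₀ * Real.log (|τ| + 2)) →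
      Continuous F → Continuous F₁ → Continuous F₂ →
      (∀ x ∈ Icc (0 : ℝ) 1, Integrable fun t : ℝ =>
        (‖F (x + t * I)‖ ^ 2 + 2 * ‖F₁ (x + t * I)‖ ^ 2 + ‖F₂ (x + t * I)‖ ^ 2) *
          Real.log (|t| + 2)) →
      (∀ x ∈ Icc (0 : ℝ) 1, ∫ t : ℝ,
        (‖F (x + t * I)‖ ^ 2 + 2 * ‖F₁ (x + t * I)‖ ^ 2 + ‖F₂ (x + t * I)‖ ^ 2) *
          Real.log (|t| + 2) ≤ B) →
      (∀ ρ ∈ ZetaZeros.riemannZetaNontrivialZeros,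
        ‖F ρ‖ ^ 2 ≤ 4 * ∫ t in Icc ((round ρ.im : ℝ) - 1) ((round ρ.im : ℝ) + 1),
          ∫ x in Icc (0 : ℝ) 1,
            (‖F (x + t * I)‖ ^ 2 + 2 * ‖F₁ (x + t * I)‖ ^ 2 + ‖F₂ (x + t * I)‖ ^ 2)) →
      Summable (fun ρ : ZetaZeros.riemannZetaNontrivialZeros =>
          (riemannZetaZeroOrder (ρ : ℂ) : ℝ) * ‖F ρ‖ ^ 2) ∧
        ∑' ρ : ZetaZeros.riemannZetaNontrivialZeros,
            (riemannZetaZeroOrder (ρ : ℂ) : ℝ) * ‖F ρ‖ ^ 2 ≤ 48 * C₀ * B := by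
  intro C₀ B F F₁ F₂ hC₀ hcount hF hF₁ hF₂ hint hB hsample
  -- joint continuity and nonnegativity of the weighted integrand
  have hlogc : Continuous fun t : ℝ => Real.log (|t| + 2) :=
    Continuous.log (by fun_prop) fun t => (by positivity : (0 : ℝ) < |t| + 2).ne'
  have hlognn : ∀ t : ℝ, 0 ≤ Real.log (|t| + 2) := fun t =>
    Real.log_nonneg (by linarith [abs_nonneg t])
  have hnn : ∀ x t : ℝ,
      0 ≤ ‖F (x + t * I)‖ ^ 2 + 2 * ‖F₁ (x + t * I)‖ ^ 2 + ‖F₂ (x + t * I)‖ ^ 2 :=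
    fun x t => by positivity
  have hnnw : ∀ x t : ℝ,
      0 ≤ (‖F (x + t * I)‖ ^ 2 + 2 * ‖F₁ (x + t * I)‖ ^ 2 + ‖F₂ (x + t * I)‖ ^ 2) *
        Real.log (|t| + 2) :=
    fun x t => mul_nonneg (hnn x t) (hlognn t)
  have hcontφ : Continuous (Function.uncurry fun (x t : ℝ) =>
      (‖F (x + t * I)‖ ^ 2 + 2 * ‖F₁ (x + t * I)‖ ^ 2 + ‖F₂ (x + t * I)‖ ^ 2) *
        Real.log (|t| + 2)) := by
    show Continuous fun p : ℝ × ℝ =>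
      (‖F ((p.1 : ℂ) + (p.2 : ℂ) * I)‖ ^ 2 + 2 * ‖F₁ ((p.1 : ℂ) + (p.2 : ℂ) * I)‖ ^ 2 +
        ‖F₂ ((p.1 : ℂ) + (p.2 : ℂ) * I)‖ ^ 2) * Real.log (|p.2| + 2)
    have h1 : Continuous fun p : ℝ × ℝ =>
        ‖F ((p.1 : ℂ) + (p.2 : ℂ) * I)‖ ^ 2 + 2 * ‖F₁ ((p.1 : ℂ) + (p.2 : ℂ) * I)‖ ^ 2 +
          ‖F₂ ((p.1 : ℂ) + (p.2 : ℂ) * I)‖ ^ 2 := by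
      fun_prop
    have h2 : Continuous fun p : ℝ × ℝ => Real.log (|p.2| + 2) := hlogc.comp continuous_snd
    exact h1.mul h2
  -- (1) the weighted budget by Fubini: `W(t) = G(t) log(|t|+2)` is integrable with `∫ W ≤ B`
  obtain ⟨hWint, hWle⟩ := zeroSampling_budget (M := B)
    (φ := fun (x t : ℝ) =>
      (‖F (x + t * I)‖ ^ 2 + 2 * ‖F₁ (x + t * I)‖ ^ 2 + ‖F₂ (x + t * I)‖ ^ 2) *
        Real.log (|t| + 2))
    hcontφ hnnw hint hB
  have hpull : ∀ t : ℝ, ∫ x in Icc (0 : ℝ) 1,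
      (‖F (x + t * I)‖ ^ 2 + 2 * ‖F₁ (x + t * I)‖ ^ 2 + ‖F₂ (x + t * I)‖ ^ 2) *
        Real.log (|t| + 2) =
      (∫ x in Icc (0 : ℝ) 1,
        (‖F (x + t * I)‖ ^ 2 + 2 * ‖F₁ (x + t * I)‖ ^ 2 + ‖F₂ (x + t * I)‖ ^ 2)) *
        Real.log (|t| + 2) :=
    fun t => integral_mul_const _ _
  have hWint' : Integrable fun t : ℝ => (∫ x in Icc (0 : ℝ) 1,
      (‖F (x + t * I)‖ ^ 2 + 2 * ‖F₁ (x + t * I)‖ ^ 2 + ‖F₂ (x + t * I)‖ ^ 2)) *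
        Real.log (|t| + 2) :=
    hWint.congr (Eventually.of_forall hpull)
  have hWle' : ∫ t : ℝ, (∫ x in Icc (0 : ℝ) 1,
      (‖F (x + t * I)‖ ^ 2 + 2 * ‖F₁ (x + t * I)‖ ^ 2 + ‖F₂ (x + t * I)‖ ^ 2)) *
        Real.log (|t| + 2) ≤ B :=
    (integral_congr_ae (Eventually.of_forall fun t => (hpull t).symm)).trans_le hWle
  have hGnn : ∀ t : ℝ, 0 ≤ ∫ x in Icc (0 : ℝ) 1,
      (‖F (x + t * I)‖ ^ 2 + 2 * ‖F₁ (x + t * I)‖ ^ 2 + ‖F₂ (x + t * I)‖ ^ 2) :=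
    fun t => integral_nonneg fun x => hnn x t
  have hWnn : ∀ t : ℝ, 0 ≤ (∫ x in Icc (0 : ℝ) 1,
      (‖F (x + t * I)‖ ^ 2 + 2 * ‖F₁ (x + t * I)‖ ^ 2 + ‖F₂ (x + t * I)‖ ^ 2)) *
        Real.log (|t| + 2) :=
    fun t => mul_nonneg (hGnn t) (hlognn t)
  have hInn : ∀ k : ℤ, 0 ≤ ∫ t in Icc ((k : ℝ) - 1) ((k : ℝ) + 1), ∫ x in Icc (0 : ℝ) 1,
      (‖F (x + t * I)‖ ^ 2 + 2 * ‖F₁ (x + t * I)‖ ^ 2 + ‖F₂ (x + t * I)‖ ^ 2) :=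
    fun k => integral_nonneg fun t => hGnn t
  have hB0 : 0 ≤ B := (integral_nonneg hWnn).trans hWle'
  -- (2) the window comparison `log(|k|+2) I(k) ≤ 2 ∫_{[k-1,k+1]} W`
  have hIJ : ∀ k : ℤ, Real.log (|(k : ℝ)| + 2) *
      (∫ t in Icc ((k : ℝ) - 1) ((k : ℝ) + 1), ∫ x in Icc (0 : ℝ) 1,
        (‖F (x + t * I)‖ ^ 2 + 2 * ‖F₁ (x + t * I)‖ ^ 2 + ‖F₂ (x + t * I)‖ ^ 2)) ≤
      2 * ∫ t in Icc ((k : ℝ) - 1) ((k : ℝ) + 1), (∫ x in Icc (0 : ℝ) 1,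
        (‖F (x + t * I)‖ ^ 2 + 2 * ‖F₁ (x + t * I)‖ ^ 2 + ‖F₂ (x + t * I)‖ ^ 2)) *
          Real.log (|t| + 2) := by
    intro k
    rw [← integral_const_mul, ← integral_const_mul]
    refine integral_mono_of_nonneg (Eventually.of_forall fun t => ?_)
      (hWint'.const_mul 2).restrict ?_
    · exact mul_nonneg (hlognn (k : ℝ)) (hGnn t)
    · rw [Filter.EventuallyLE, ae_restrict_iff' measurableSet_Icc]
      refine ae_of_all _ fun t ht => ?_
      have h1 := logAssembly_log_le ht
      have h2 := hGnn t
      calc Real.log (|(k : ℝ)| + 2) * (∫ x in Icc (0 : ℝ) 1,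
            (‖F (x + t * I)‖ ^ 2 + 2 * ‖F₁ (x + t * I)‖ ^ 2 + ‖F₂ (x + t * I)‖ ^ 2))
          ≤ (2 * Real.log (|t| + 2)) * (∫ x in Icc (0 : ℝ) 1,
            (‖F (x + t * I)‖ ^ 2 + 2 * ‖F₁ (x + t * I)‖ ^ 2 + ‖F₂ (x + t * I)‖ ^ 2)) :=
            mul_le_mul_of_nonneg_right h1 h2
        _ = 2 * ((∫ x in Icc (0 : ℝ) 1,
            (‖F (x + t * I)‖ ^ 2 + 2 * ‖F₁ (x + t * I)‖ ^ 2 + ‖F₂ (x + t * I)‖ ^ 2)) *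
              Real.log (|t| + 2)) := by ring
  -- (3) threefold overlap of the windows
  have hwin : ∀ S : Finset ℤ,
      ∑ k ∈ S, ∫ t in Icc ((k : ℝ) - 1) ((k : ℝ) + 1), (∫ x in Icc (0 : ℝ) 1,
        (‖F (x + t * I)‖ ^ 2 + 2 * ‖F₁ (x + t * I)‖ ^ 2 + ‖F₂ (x + t * I)‖ ^ 2)) *
          Real.log (|t| + 2) ≤ 3 * B :=
    fun S => (zeroSampling_sum_window_le hWint' hWnn S).trans (by linarith)
  -- (4) uniform bound on the finite partial sums, summability, `tsum` bound
  have hfnn : ∀ ρ : ZetaZeros.riemannZetaNontrivialZeros,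
      0 ≤ (riemannZetaZeroOrder (ρ : ℂ) : ℝ) * ‖F ρ‖ ^ 2 := by
    intro ρ
    have hm : (0 : ℝ) ≤ riemannZetaZeroOrder (ρ : ℂ) := by
      exact_mod_cast riemannZetaZeroOrder_nonneg (ZetaZeros.riemannZetaNontrivialZeros.ne_one ρ.2)
    exact mul_nonneg hm (sq_nonneg _)
  have hsum : ∀ T : Finset ZetaZeros.riemannZetaNontrivialZeros,
      ∑ ρ ∈ T, (riemannZetaZeroOrder (ρ : ℂ) : ℝ) * ‖F ρ‖ ^ 2 ≤ 48 * C₀ * B := by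
    intro T
    have h1 : ∑ ρ ∈ T, (riemannZetaZeroOrder (ρ : ℂ) : ℝ) * ‖F ρ‖ ^ 2 =
        ∑ ρ ∈ T.map (Function.Embedding.subtype _),
          (riemannZetaZeroOrder ρ : ℝ) * ‖F ρ‖ ^ 2 := by
      rw [Finset.sum_map]; rfl
    rw [h1]
    have hT' : ∀ ρ ∈ T.map (Function.Embedding.subtype _),
        ρ ∈ ZetaZeros.riemannZetaNontrivialZeros := by
      intro ρ hρ
      rw [Finset.mem_map] at hρ
      obtain ⟨ρ', -, rfl⟩ := hρ
      exact ρ'.2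
    refine (logAssembly_finset_le
      (I := fun k : ℤ => ∫ t in Icc ((k : ℝ) - 1) ((k : ℝ) + 1), ∫ x in Icc (0 : ℝ) 1,
        (‖F (x + t * I)‖ ^ 2 + 2 * ‖F₁ (x + t * I)‖ ^ 2 + ‖F₂ (x + t * I)‖ ^ 2))
      (J := fun k : ℤ => ∫ t in Icc ((k : ℝ) - 1) ((k : ℝ) + 1), (∫ x in Icc (0 : ℝ) 1,
        (‖F (x + t * I)‖ ^ 2 + 2 * ‖F₁ (x + t * I)‖ ^ 2 + ‖F₂ (x + t * I)‖ ^ 2)) *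
          Real.log (|t| + 2))
      hC₀ hcount hInn hIJ (fun ρ hρ => hsample ρ hρ) _ hT').trans ?_
    calc 8 * C₀ * ∑ k ∈ (T.map (Function.Embedding.subtype _)).image (fun ρ : ℂ => round ρ.im),
          ∫ t in Icc ((k : ℝ) - 1) ((k : ℝ) + 1), (∫ x in Icc (0 : ℝ) 1,
            (‖F (x + t * I)‖ ^ 2 + 2 * ‖F₁ (x + t * I)‖ ^ 2 + ‖F₂ (x + t * I)‖ ^ 2)) *
              Real.log (|t| + 2)
        ≤ 8 * C₀ * (3 * B) := mul_le_mul_of_nonneg_left (hwin _) (by positivity)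
      _ = 24 * C₀ * B := by ring
      _ ≤ 48 * C₀ * B := by nlinarith [mul_nonneg hC₀ hB0]
  have hsumm : Summable (fun ρ : ZetaZeros.riemannZetaNontrivialZeros =>
      (riemannZetaZeroOrder (ρ : ℂ) : ℝ) * ‖F ρ‖ ^ 2) :=
    summable_of_sum_le hfnn hsum
  exact ⟨hsumm, hsumm.tsum_le_of_sum_le hsum⟩

end Summit.RiemannHypothesis.RiemannHypothesis.Theorems.GroundStatesConvergeToXi

end
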